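import Summits.QuantumAdvantage.QuantumAdvantage.Theorems.WalkKFormLossA
import HarnessLib

/-!
# Inverse-polynomial LOSS for every `k`-form / junta ⊕ linear-form (JLin) strategy of the u-walk game, `p ≥ 5` — PART B
(cell decomp-qadv, lens 6 «barrier-complement carving», g20; tree-ready, Prop-definition-free; Part A = `Theorems.WalkKFormLossA`
holds the subcube law `kForm_loss_ge` / `jlin_loss_ge` and the counting inequality `count_log_loss`; the full overview is in Part A.)

This part: §4 `jlinPolyLossOdd` (+ `_towerDefs`, `_real`) — the `1/poly` shadow of CharDial items 32604 / 27206 / 27207 (and the JLin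
slice of AbsorptionDial item 26767), PROVED; §5 `polyLossFrob_of_frobStructureLawOdd` — the `1/poly` Frobenius notch from item 27205
alone; §6 `kFormPolyLossOdd`, `polyLossDeg_of_structureLawK`, `noPerfectDeg_of_structureLawK` — every degree rung of the `1/poly` and
exact ladders from a `K`-form structure law alone; §7 `formPolyLossOdd` (+ `_real`) — the `1/poly` shadow of the pure-form core
`TowerDefs.FormHard`, PROVED.  Ceiling of the method: density `2^{−m}` hitting sets — the constant-θ items are NOT touched.

0 sorry; axioms standard; no `instance`, no `notation`, no `native_decide`.
-/

open Finset

namespace Summit.QuantumAdvantage.AdviceFreeQNC0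

namespace Coset21

/-! ### §4 The inverse-polynomial shadow of CharDial's JLin class (items 32604, 27206, 27207) -/

section JLinPolyLoss

/-- **Inverse-polynomial loss for every junta(`≤ log₂ n`) ⊕ ONE linear form strategy, every prime `p ≥ 5`** (the
`1/poly` shadow of `CharDial.WalkHardFJLinOdd` = item 32604 and of both residual pieces `JLinLowResidual5` / `JLinResidualHigh5`
= items 27206 / 27207, PROVED; the exact shadow is `PerfectDial.noPerfect_jlin_log`): there are `k, n₀` such that for all
`n ≥ n₀`, every charge `c` and every such strategy, `2ⁿ ≤ n^k · #{u : the strategy loses at u}`. -/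
theorem jlinPolyLossOdd : ∀ (p : ℕ) [Fact p.Prime], 5 ≤ p → ∃ k n₀ : ℕ, ∀ n ≥ n₀, ∀ c : ℕ,
    ∀ y : Fin (n + 1) → (Fin n → Bool) → Bool,
      (∀ g, ∃ J : Finset (Fin n), J.card ≤ Nat.log 2 n ∧ ∃ a : Fin n → ZMod p, ∃ h : (Fin n → Bool) → ZMod p → Bool,
        (∀ u v : Fin n → Bool, (∀ i ∈ J, u i = v i) → ∀ s, h u s = h v s) ∧
          ∀ u, y g u = h u (∑ i, if u i then a i else 0)) →
      2 ^ n ≤ n ^ k * (Finset.univ.filter fun u : Fin n → Bool => ringWinU c y u = false).card := by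
  intro p _ hp
  obtain ⟨k₀, n₀, hn₀⟩ := count_log_loss p (by omega)
  refine ⟨k₀, max n₀ 1, fun n hn c y hy => ?_⟩
  obtain ⟨hm, hcount⟩ := hn₀ n (le_trans (le_max_left _ _) hn)
  have hn0 : n ≠ 0 := by have := le_trans (le_max_right _ _) hn; omega
  have hloss := jlin_loss_ge p hp (k₀ * Nat.log 2 n) hm hcount c y hy
  -- `2^{k₀ log₂ n} ≤ n^{k₀}`
  have hpoly : 2 ^ (k₀ * Nat.log 2 n) ≤ n ^ k₀ := by
    rw [mul_comm, pow_mul]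
    exact Nat.pow_le_pow_left (Nat.pow_log_le_self 2 hn0) _
  calc 2 ^ n = 2 ^ (k₀ * Nat.log 2 n) * 2 ^ (n - k₀ * Nat.log 2 n) := by
        rw [← pow_add, Nat.add_sub_cancel' hm]
    _ ≤ n ^ k₀ * (Finset.univ.filter fun u : Fin n → Bool => ringWinU c y u = false).card :=
        Nat.mul_le_mul hpoly hloss

/-- `jlinPolyLossOdd` with the hypothesis BY NAME: `JLinPeel.TowerDefs.JLinHyp p n y` (the verbatim hypothesis of item 32604 in the
definitions-only tower module `Theorems.CharDialTowerDefs`). -/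
theorem jlinPolyLossOdd_towerDefs : ∀ (p : ℕ) [Fact p.Prime], 5 ≤ p → ∃ k n₀ : ℕ, ∀ n ≥ n₀, ∀ c : ℕ,
    ∀ y : Fin (n + 1) → (Fin n → Bool) → Bool, JLinPeel.TowerDefs.JLinHyp p n y →
      2 ^ n ≤ n ^ k * (Finset.univ.filter fun u : Fin n → Bool => ringWinU c y u = false).card :=
  fun p _ hp => jlinPolyLossOdd p hp

/-- win and loss counts partition the cube. -/
theorem card_win_add_card_loss {n : ℕ} (c : ℕ) (y : Fin (n + 1) → (Fin n → Bool) → Bool) :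
    (univ.filter fun u : Fin n → Bool => ringWinU c y u = true).card
      + (univ.filter fun u : Fin n → Bool => ringWinU c y u = false).card = 2 ^ n := by
  have h := Finset.card_filter_add_card_filter_not (s := (univ : Finset (Fin n → Bool)))
    (fun u : Fin n → Bool => ringWinU c y u = true)
  have e : (univ.filter fun u : Fin n → Bool => ¬ ringWinU c y u = true)
      = univ.filter fun u : Fin n → Bool => ringWinU c y u = false :=
    filter_congr fun u _ => by simp
  rw [e] at h
  rw [h, card_univ, Fintype.card_fun, Fintype.card_bool, Fintype.card_fin]

/-- **`jlinPolyLossOdd` in the currency of `AbsorptionDial.WalkPolyLossOdd` (item 26767)**: the win count of a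
junta(`≤ log₂ n`) ⊕ one-form strategy is at most `(1 − n^{−k})·2ⁿ` — the JLin slice of item 26767 is a theorem (its
linear-test slice was `linSelSubcubeLossOdd`). -/
theorem jlinPolyLossOdd_real : ∀ (p : ℕ) [Fact p.Prime], 5 ≤ p → ∃ k n₀ : ℕ, ∀ n ≥ n₀, ∀ c : ℕ,
    ∀ y : Fin (n + 1) → (Fin n → Bool) → Bool,
      (∀ g, ∃ J : Finset (Fin n), J.card ≤ Nat.log 2 n ∧ ∃ a : Fin n → ZMod p, ∃ h : (Fin n → Bool) → ZMod p → Bool,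
        (∀ u v : Fin n → Bool, (∀ i ∈ J, u i = v i) → ∀ s, h u s = h v s) ∧
          ∀ u, y g u = h u (∑ i, if u i then a i else 0)) →
      ((Finset.univ.filter fun u : Fin n → Bool => ringWinU c y u = true).card : ℝ)
        ≤ (1 - 1 / (n : ℝ) ^ k) * (2 : ℝ) ^ n := by
  intro p _ hp
  obtain ⟨k, n₀, hn₀⟩ := jlinPolyLossOdd p hp
  refine ⟨k, max n₀ 1, fun n hn c y hy => ?_⟩
  have hnat := hn₀ n (le_trans (le_max_left _ _) hn) c y hy
  have hn1 : 1 ≤ n := le_trans (le_max_right _ _) hn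
  have hsum := card_win_add_card_loss c y
  set W := (univ.filter fun u : Fin n → Bool => ringWinU c y u = true).card with hW
  set Lo := (univ.filter fun u : Fin n → Bool => ringWinU c y u = false).card with hLo
  have hnk : (0 : ℝ) < (n : ℝ) ^ k := by positivity
  have hnat' : ((2 : ℝ) ^ n) ≤ (n : ℝ) ^ k * (Lo : ℝ) := by exact_mod_cast hnat
  have hsum' : (W : ℝ) + (Lo : ℝ) = (2 : ℝ) ^ n := by exact_mod_cast hsum
  have hLo' : (2 : ℝ) ^ n / (n : ℝ) ^ k ≤ (Lo : ℝ) := by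
    rw [div_le_iff₀ hnk]; linarith [hnat']
  calc (W : ℝ) = (2 : ℝ) ^ n - Lo := by linarith
    _ ≤ (2 : ℝ) ^ n - (2 : ℝ) ^ n / (n : ℝ) ^ k := by linarith
    _ = (1 - 1 / (n : ℝ) ^ k) * (2 : ℝ) ^ n := by ring

end JLinPolyLoss

/-! ### §5 The inverse-polynomial Frobenius notch needs the STRUCTURE LAW ALONE -/

section FrobNotch

/-- **THE `1/poly` FROBENIUS NOTCH FROM ITEM 27205 ALONE.**  `CharDial.FrobStructureLawOdd` (item 27205: for `p ≥ 5` a Boolean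
function of `𝔽_p`-degree `≤ p − 1` is a junta of constant size `J₀(p)` ⊕ ONE linear form) implies that for every prime `p ≥ 5`
there are `k, n₀` with `2ⁿ ≤ n^k · #{losing inputs}` for every `n ≥ n₀`, every charge and every strategy with cuts of
`𝔽_p`-degree `≤ p − 1`.  (The θ < 1 notch `FrobHardOdd` = item 32598 needs 27205 AND 27206 AND 27207; its exact shadow needs
27205 alone by `PerfectDial.noPerfect_of_frobStructureLaw`; this is the inverse-polynomial shadow, again from 27205 alone.) -/
theorem polyLossFrob_of_frobStructureLawOdd
    (hS : Summit.QuantumAdvantage.QuantumAdvantage.Theses.CharDial.FrobStructureLawOdd) :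
    ∀ (p : ℕ) [Fact p.Prime], 5 ≤ p → ∃ k n₀ : ℕ, ∀ n ≥ n₀, ∀ c : ℕ, ∀ y : Fin (n + 1) → (Fin n → Bool) → Bool,
      (∀ g, HasDegF p (y g) (p - 1)) →
        2 ^ n ≤ n ^ k * (Finset.univ.filter fun u : Fin n → Bool => ringWinU c y u = false).card := by
  intro p _ hp
  obtain ⟨J₀, hJ₀⟩ := hS p hp
  obtain ⟨k, n₀, hn₀⟩ := jlinPolyLossOdd p hp
  refine ⟨k, max n₀ (2 ^ J₀), fun n hn c y hy => hn₀ n (le_trans (le_max_left _ _) hn) c y fun g => ?_⟩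
  obtain ⟨J, hJ, a, h, hjun, hrep⟩ := hJ₀ n (y g) (hy g)
  have hJ₀n : J₀ ≤ Nat.log 2 n :=
    calc J₀ = Nat.log 2 (2 ^ J₀) := (Nat.log_pow (by norm_num) _).symm
      _ ≤ Nat.log 2 n := Nat.log_mono_right (le_trans (le_max_right _ _) hn)
  exact ⟨J, le_trans hJ hJ₀n, a, h, hjun, hrep⟩

/-- The same from the all-primes aside `CharDial.FrobStructureLaw` (item 32603), by restriction to `p ≥ 5`. -/
theorem polyLossFrob_of_frobStructureLaw
    (hS : Summit.QuantumAdvantage.QuantumAdvantage.Theses.CharDial.FrobStructureLaw) :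
    ∀ (p : ℕ) [Fact p.Prime], 5 ≤ p → ∃ k n₀ : ℕ, ∀ n ≥ n₀, ∀ c : ℕ, ∀ y : Fin (n + 1) → (Fin n → Bool) → Bool,
      (∀ g, HasDegF p (y g) (p - 1)) →
        2 ^ n ≤ n ^ k * (Finset.univ.filter fun u : Fin n → Bool => ringWinU c y u = false).card :=
  polyLossFrob_of_frobStructureLawOdd fun p _ _ => hS p

end FrobNotch

/-! ### §6 Constant-`K` forms: the `1/poly` loss law for `K`-form strategies and the DEGREE RUNGS from structure laws alone -/

section StructureLaw

/-- **Inverse-polynomial loss for `K`-form strategies (`K` fixed).**  For every prime `p ≥ 5` and every `K` there are `k, n₀` with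
`2ⁿ ≤ n^k · #{losing inputs}` for every `n ≥ n₀`, every charge and every strategy each of whose cuts is an arbitrary table of `K`
linear forms `mod p` of the input (junta bits are coordinate forms, so «junta of size `J` ⊕ `K'` forms» is the case `K = J + K'`). -/
theorem kFormPolyLossOdd (p : ℕ) [Fact p.Prime] (hp : 5 ≤ p) (K : ℕ) : ∃ k n₀ : ℕ, ∀ n ≥ n₀, ∀ c : ℕ,
    ∀ (lam : Fin (n + 1) → Fin K → Fin n → ZMod p) (F : Fin (n + 1) → (Fin K → ZMod p) → Bool)
      (y : Fin (n + 1) → (Fin n → Bool) → Bool),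
      (∀ g u, y g u = F g (fun j => ∑ i, if u i = true then lam g j i else 0)) →
        2 ^ n ≤ n ^ k * (Finset.univ.filter fun u : Fin n → Bool => ringWinU c y u = false).card := by
  obtain ⟨k₀, n₀, hn₀⟩ := count_log_loss p (by omega)
  refine ⟨k₀, max n₀ (2 ^ K), fun n hn c lam F y hy => ?_⟩
  obtain ⟨hm, hcount⟩ := hn₀ n (le_trans (le_max_left _ _) hn)
  have h2K : 2 ^ K ≤ n := le_trans (le_max_right _ _) hn
  have hn0 : n ≠ 0 := by have := Nat.one_le_two_pow (n := K); omega
  have hK : K ≤ Nat.log 2 n :=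
    calc K = Nat.log 2 (2 ^ K) := (Nat.log_pow (by norm_num) _).symm
      _ ≤ Nat.log 2 n := Nat.log_mono_right h2K
  have hp0 : 0 < p := by omega
  -- `p^K ≤ p^{log₂ n + 1}`, so the counting inequality of `count_log_loss` covers `K` forms
  have hcount' : (n + 1) * (p ^ K * 2) * (2 * p - 1) ^ (k₀ * Nat.log 2 n) < (2 * p) ^ (k₀ * Nat.log 2 n) :=
    lt_of_le_of_lt (Nat.mul_le_mul_right _ (Nat.mul_le_mul_left _ (Nat.mul_le_mul_right _
      (Nat.pow_le_pow_right hp0 (by omega))))) hcount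
  have hloss := kForm_loss_ge p hp (k₀ * Nat.log 2 n) hm hcount' c lam F y hy
  have hpoly : 2 ^ (k₀ * Nat.log 2 n) ≤ n ^ k₀ := by
    rw [mul_comm, pow_mul]
    exact Nat.pow_le_pow_left (Nat.pow_log_le_self 2 hn0) _
  calc 2 ^ n = 2 ^ (k₀ * Nat.log 2 n) * 2 ^ (n - k₀ * Nat.log 2 n) := by
        rw [← pow_add, Nat.add_sub_cancel' hm]
    _ ≤ n ^ k₀ * (Finset.univ.filter fun u : Fin n → Bool => ringWinU c y u = false).card :=
        Nat.mul_le_mul hpoly hloss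

/-- **THE `1/poly` DEGREE-`d` RUNG FROM A `K`-FORM STRUCTURE LAW ALONE** (definition-free; the pattern of
`AbsorptionDial.degF_fail_floor_of_junta`).  Hypothesis `hSL` = «every Boolean function of `𝔽_p`-degree `≤ d` (on any number of bits)
is a function of `K` linear forms `mod p`»: for `d ≤ p − 2` this is the junta law [Sun–Sun–Wang–Wu–Xia–Zheng, arXiv:1910.12458, Thm 2,
`k = 1`] (a junta is a function of coordinate forms); for `d = p − 1` it follows from `CharDial.FrobStructureLawOdd` (item 27205, `K = J₀+1`,
`PerfectDial.kform_of_jlin`); for `p ≤ d ≤ 2p − 3` it is the conjectural SECOND STRUCTURE LAW (lens-6 g20 node, piece `StructureLawK`).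
Conclusion: inverse-polynomial loss for every strategy with cuts of `𝔽_p`-degree `≤ d`, every `p ≥ 5`. -/
theorem polyLossDeg_of_structureLawK {p : ℕ} [Fact p.Prime] (hp : 5 ≤ p) {d K : ℕ}
    (hSL : ∀ (m : ℕ) (f : (Fin m → Bool) → Bool), HasDegF p f d →
      ∃ lam : Fin K → Fin m → ZMod p, ∃ F : (Fin K → ZMod p) → Bool,
        ∀ u, f u = F (fun j => ∑ i, if u i = true then lam j i else 0)) :
    ∃ k n₀ : ℕ, ∀ n ≥ n₀, ∀ c : ℕ, ∀ y : Fin (n + 1) → (Fin n → Bool) → Bool, (∀ g, HasDegF p (y g) d) →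
      2 ^ n ≤ n ^ k * (Finset.univ.filter fun u : Fin n → Bool => ringWinU c y u = false).card := by
  obtain ⟨k, n₀, h⟩ := kFormPolyLossOdd p hp K
  refine ⟨k, n₀, fun n hn c y hy => ?_⟩
  choose lam F hF using fun g => hSL n (y g) (hy g)
  exact h n hn c lam F y fun g u => hF g u

/-- The EXACT-grade version: a `K`-form structure law at degree `d` alone gives «no perfect strategy with cuts of `𝔽_p`-degree `≤ d`»
(every `p ≥ 5`, eventually in `n`). -/
theorem noPerfectDeg_of_structureLawK {p : ℕ} [Fact p.Prime] (hp : 5 ≤ p) {d K : ℕ}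
    (hSL : ∀ (m : ℕ) (f : (Fin m → Bool) → Bool), HasDegF p f d →
      ∃ lam : Fin K → Fin m → ZMod p, ∃ F : (Fin K → ZMod p) → Bool,
        ∀ u, f u = F (fun j => ∑ i, if u i = true then lam j i else 0)) :
    ∃ n₀ : ℕ, ∀ n ≥ n₀, ∀ c : ℕ, ∀ y : Fin (n + 1) → (Fin n → Bool) → Bool, (∀ g, HasDegF p (y g) d) →
      ∃ u, ringWinU c y u = false := by
  obtain ⟨k, n₀, h⟩ := polyLossDeg_of_structureLawK hp hSL
  refine ⟨max n₀ 1, fun n hn c y hy => ?_⟩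
  have hle := h n (le_trans (le_max_left _ _) hn) c y hy
  by_contra hno
  have h0 : (Finset.univ.filter fun u : Fin n → Bool => ringWinU c y u = false).card = 0 := by
    rw [Finset.card_eq_zero, Finset.filter_eq_empty_iff]
    intro u _ hu
    exact hno ⟨u, hu⟩
  rw [h0, mul_zero] at hle
  exact absurd hle (not_le.mpr (by positivity))

end StructureLaw

/-! ### §7 The pure-form core `TowerDefs.FormHard` (tree, `Theorems.CharDialTokenDialT`): its `1/poly` shadow, PROVED -/

section FormCore

/-- **`FormHard`'s inverse-polynomial shadow is a theorem.**  `TowerDefs.FormHard` (the PURE-FORM CORE of `T` = item 32604: every cut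
an arbitrary table of ONE linear form; `formHard_of_T`, `lazyFormHard5_of_formHard`, `lazyFormHard5_of_jlinLowResidual5` in the tree)
asserts `#WIN ≤ θ·2ⁿ`; unconditionally `2ⁿ ≤ n^k · #LOSS` for every pure-form strategy (`pureFormY_jlin` + `jlinPolyLossOdd_towerDefs`). -/
theorem formPolyLossOdd : ∀ (p : ℕ) [Fact p.Prime], 5 ≤ p → ∃ k n₀ : ℕ, ∀ n ≥ n₀, ∀ c : ℕ,
    ∀ (a : Fin (n + 1) → Fin n → ZMod p) (H : Fin (n + 1) → ZMod p → Bool),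
      2 ^ n ≤ n ^ k * (Finset.univ.filter fun u : Fin n → Bool =>
        ringWinU c (JLinPeel.TokenDial.pureFormY a H) u = false).card := by
  intro p _ hp
  obtain ⟨k, n₀, h⟩ := jlinPolyLossOdd_towerDefs p hp
  exact ⟨k, n₀, fun n hn c a H => h n hn c _ (JLinPeel.TokenDial.pureFormY_jlin a H)⟩

/-- the same in `FormHard`'s own currency: `#WIN ≤ (1 − n^{−k})·2ⁿ` for every pure-form strategy. -/
theorem formPolyLossOdd_real : ∀ (p : ℕ) [Fact p.Prime], 5 ≤ p → ∃ k n₀ : ℕ, ∀ n ≥ n₀, ∀ c : ℕ,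
    ∀ (a : Fin (n + 1) → Fin n → ZMod p) (H : Fin (n + 1) → ZMod p → Bool),
      ((Finset.univ.filter fun u : Fin n → Bool =>
          ringWinU c (JLinPeel.TokenDial.pureFormY a H) u = true).card : ℝ) ≤ (1 - 1 / (n : ℝ) ^ k) * (2 : ℝ) ^ n := by
  intro p _ hp
  obtain ⟨k, n₀, h⟩ := jlinPolyLossOdd_real p hp
  exact ⟨k, n₀, fun n hn c a H => h n hn c _ (JLinPeel.TokenDial.pureFormY_jlin a H)⟩

end FormCore

end Coset21

end Summit.QuantumAdvantage.AdviceFreeQNC0
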